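import Mathlib
import Summits.MatrixMultiplication.MatrixMultiplication.Theorems.SnSubsetDichotomyPolynomialSlackHubDyadic
import Summits.MatrixMultiplication.MatrixMultiplication.Theorems.SnSubsetDichotomyPolynomialSlackStubSplit
import Summits.MatrixMultiplication.MatrixMultiplication.Theorems.SnSubsetDichotomyPolynomialSlackSpreadLevelOne

/-!
# Two dense quotients: a DOMINANT row gives the volume bound with local forced hits

Crux `Summit.MatrixMultiplication.MatrixMultiplication.Theses.SnSubsetDichotomy.PolynomialSlack`
(item `stmt-MatrixMultiplication-8306`), level-one programme, lead c8 (two dense quotients: dominant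
row ⇒ done at every exponent), line transport-split-hull.

In the two-dense endgame `A = S⁻¹T` and `B = T⁻¹U` are dense quotient sets and `C = U⁻¹S` is sparse,
with profile `d_C` and heavy part `p_C = (d_C - 1/n)·[d_C ≥ θ_C]` at a level `θ_C ≥ 16/n`. The rows
of `p_C` are `U`-positions `k`; `ρ_k = Σ_i p_C(k,i)` is the heavy row mass and
`Φ_k = Σ_i p_C(k,i)·Σ_j d_A(i,j) d_B(j,k) ≥ 0` the row's forced hits; the kept identity reads
`1 - δ ≤ Σ_k [((n-1)/n)ρ_k - (n-1)Φ_k]`. A row `k` is DOMINANT when it carries `1 - ε` by itself,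
`1 - ε ≤ ((n-1)/n)ρ_k - (n-1)Φ_k` with `0 < ε ≤ 1/(7776(1+log n)⁴)`. Then (`volume_le_of_dominant_row`)

  `|S||T||U| ≤ 12288·(9600²·9⁴)·(1+log n)^{10}·LL²·ε·n·B`

for every bound `B` on the volumes of TPP triples of `S_{n-1}` and every `LL ≥ log(6n!/(|S||T|))`.
This is the hub-row lemma `twoDense_rowHub_volume` (file `…TwoDenseRowHub`, whose proof is repeated
here) at `τ = 1/2`, `η₀ = ε`, with the hub row GIVEN and the GLOBAL forced-hit hypothesis replaced by
the LOCAL one read off from dominance: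

* `ρ_k ∈ [0,1]` (`p_C ≤ d_C`, row sums of `d_C` are `1`, `sum_pairMarginal_snd`) and `Φ_k ≥ 0`, so
  `ρ_k ≥ ((n-1)/n)ρ_k ≥ 1 - ε ≥ 1/2 = τ` (`τ ≥ 2/n` as `n ≥ 4`) and
  `(n-1)Φ_k ≤ (n-1)/n - (1-ε) ≤ ε`, `Φ_k ≤ 2ε/n`;
* the general hub lemma `hub_volume_dyadic` at the hub `k` with `J = {j : d_B(j,k) ≥ 1/n²}`,
  `I = {i : d_C(k,i) ≥ θ_C}`, `q = (τ - 1/n)/2 ≥ τ/4 = 1/8`, `η = 3ε`: hub mass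
  `Σ_v μXY ≥ Σ_v μ(X + Y - 1) ≥ τ - 1/n = 2q` (`sum_pairMarginal_row/col_block_eq`, unit column sums
  `sum_pairMarginal_fst`, `Σ_v μ = 1` by `sum_marginal_col`), block weight
  `Σ_{I×J} d_A d_B d_C ≤ (16/15)Φ_k ≤ (16/15)·2ε/n ≤ 3ε/n` (`d_C ≤ (16/15)p_C` on heavy cells), and
  `81(1+log n)⁴·3ε ≤ 2q²` from `7776(1+log n)⁴ ε ≤ 1` and `q ≥ 1/8`;
* the conclusion `|S||T||U| ≤ 9600²·9⁴·(1+log n)^{10}·L_A²·n·3ε·B/q⁴` with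
  `0 ≤ L_A = log(6n!/(|S||T|)) ≤ LL` (`card_mul_card_le_factorial_of_injOn`) and `1/q⁴ ≤ 8⁴`,
  `3·8⁴ = 12288`.
-/

namespace Summit.MatrixMultiplication.MatrixMultiplication.Theorems.PolynomialSlack

open scoped BigOperators
open Literature.Combinatorics.Additive (TripleProductProperty)

-- `Summit.<Summit>.<Problem>` is the tree's mandated summit-side namespace (CONVENTIONS §2); for
-- this single-conjunct summit the two coincide, so each declaration silences `dupNamespace`.
set_option linter.dupNamespace false

/-- Summed form of `XY ≥ X + Y - 1` (i.e. `0 ≤ (1-X)(1-Y)`) against nonnegative weights `μ`: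
`Σ μY + Σ μX - Σ μ ≤ Σ μ·(XY)` whenever `μ ≥ 0` and `X, Y ≤ 1`. [folklore] -/
private theorem dominantRow_sum_mul_mul_ge {ι : Type*} (s : Finset ι) (μ X Y : ι → ℝ)
    (hμ : ∀ v ∈ s, 0 ≤ μ v) (hX : ∀ v ∈ s, X v ≤ 1) (hY : ∀ v ∈ s, Y v ≤ 1) :
    ∑ v ∈ s, μ v * Y v + ∑ v ∈ s, μ v * X v - ∑ v ∈ s, μ v ≤ ∑ v ∈ s, μ v * (X v * Y v) := by
  rw [← Finset.sum_add_distrib, ← Finset.sum_sub_distrib]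
  refine Finset.sum_le_sum fun v hv => ?_
  have h1 : 0 ≤ (1 - X v) * (1 - Y v) := mul_nonneg (by linarith [hX v hv]) (by linarith [hY v hv])
  nlinarith [hμ v hv, h1, mul_nonneg (hμ v hv) h1]

/-- The final arithmetic of `volume_le_of_dominant_row`: from
`N ≤ 9600²·9⁴·G^{10}·L²·m·(3η₀)·b/q⁴` with `0 ≤ L ≤ LL`, `1/8 ≤ q`, `m, η₀ > 0`, `b ≥ 0` to
`N ≤ 12288·(9600²·9⁴)·G^{10}·LL²·η₀·m·b` (`1/q⁴ ≤ 8⁴`, `3·8⁴ = 12288`). [folklore] -/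
private theorem dominantRow_arith (N G L LL m η₀ b q : ℝ) (hL0 : 0 ≤ L) (hL : L ≤ LL)
    (hq8 : 1 / 8 ≤ q) (hm : 0 < m) (hη₀ : 0 < η₀) (hb : 0 ≤ b)
    (h : N ≤ 9600 ^ 2 * 9 ^ 4 * G ^ 10 * L ^ 2 * m * (3 * η₀) * b / q ^ 4) :
    N ≤ 12288 * (9600 ^ 2 * 9 ^ 4) * G ^ 10 * LL ^ 2 * η₀ * m * b := by
  have hG : 0 ≤ G ^ 10 := by positivity
  have hLL2 : L ^ 2 ≤ LL ^ 2 := pow_le_pow_left₀ hL0 hL 2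
  have h80 : (0 : ℝ) < 1 / 8 := by norm_num
  have hq0 : 0 < q := lt_of_lt_of_le h80 hq8
  have hq4 : (1 / 8 : ℝ) ^ 4 ≤ q ^ 4 := pow_le_pow_left₀ h80.le hq8 4
  have hK : 0 ≤ 9600 ^ 2 * 9 ^ 4 * G ^ 10 * m * (3 * η₀) * b :=
    mul_nonneg (mul_nonneg (mul_nonneg (by positivity) hm.le) (by linarith)) hb
  have hK' : 0 ≤ 9600 ^ 2 * 9 ^ 4 * G ^ 10 * LL ^ 2 * m * (3 * η₀) * b :=
    mul_nonneg (mul_nonneg (mul_nonneg (mul_nonneg (by positivity) (sq_nonneg LL)) hm.le)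
      (by linarith)) hb
  calc N ≤ _ := h
    _ ≤ 9600 ^ 2 * 9 ^ 4 * G ^ 10 * LL ^ 2 * m * (3 * η₀) * b / q ^ 4 := by
        apply div_le_div_of_nonneg_right _ (by positivity)
        calc 9600 ^ 2 * 9 ^ 4 * G ^ 10 * L ^ 2 * m * (3 * η₀) * b
            = 9600 ^ 2 * 9 ^ 4 * G ^ 10 * m * (3 * η₀) * b * L ^ 2 := by ring
          _ ≤ 9600 ^ 2 * 9 ^ 4 * G ^ 10 * m * (3 * η₀) * b * LL ^ 2 :=
              mul_le_mul_of_nonneg_left hLL2 hK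
          _ = _ := by ring
    _ ≤ 9600 ^ 2 * 9 ^ 4 * G ^ 10 * LL ^ 2 * m * (3 * η₀) * b / (1 / 8) ^ 4 :=
        div_le_div_of_nonneg_left hK' (pow_pos h80 4) hq4
    _ = 12288 * (9600 ^ 2 * 9 ^ 4) * G ^ 10 * LL ^ 2 * η₀ * m * b := by ring

set_option maxHeartbeats 1600000 in
/-- **Two dense quotients, a dominant row.** For `n ≥ 4`, a bound `B` on the volumes of TPP triples
of `S_{n-1}`, a TPP triple `S, T, U ⊆ S_n` of non-empty sets with quotient profiles `dA, dB, dC`, the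
heavy part `pC = (dC - 1/n)·[dC ≥ θC]` of `dC` at a level `θC ≥ 16/n`, `LL ≥ log(6n!/(|S||T|))`,
`0 < ε ≤ 1/(7776(1+log n)⁴)`, and a `U`-position `k` whose row is DOMINANT,
`1 - ε ≤ ((n-1)/n)·Σ_i pC(k,i) - (n-1)·Σ_i pC(k,i)·Σ_j dA(i,j) dB(j,k)`:
`|S||T||U| ≤ 12288·(9600²·9⁴)·(1+log n)^{10}·LL²·ε·n·B` (the hub-row lemma `twoDense_rowHub_volume`
at `τ = 1/2`, `η₀ = ε`, with the global forced-hit hypothesis replaced by the local one read off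
from dominance; the general hub lemma `hub_volume_dyadic` at the hub `k` with `J = {d_B(·,k) ≥ 1/n²}`,
`I = {d_C(k,·) ≥ θ_C}`, `q = (1/2 - 1/n)/2`, `η = 3ε`). [folklore] -/
theorem volume_le_of_dominant_row {n : ℕ} (hn : 4 ≤ n) (B : ℕ)
    (hB : ∀ S' T' U' : Finset (Equiv.Perm (Fin (n - 1))), TripleProductProperty S' T' U' →
      S'.card * T'.card * U'.card ≤ B)
    {S T U : Finset (Equiv.Perm (Fin n))} (hTPP : TripleProductProperty S T U)
    (hS0 : S.Nonempty) (hT0 : T.Nonempty) (hU0 : U.Nonempty)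
    (dA dB dC pC : Fin n → Fin n → ℝ)
    (hdA : ∀ i j, dA i j = (((S ×ˢ T).filter fun st => st.2 j = st.1 i).card : ℝ) / (S.card * T.card : ℕ))
    (hdB : ∀ j k, dB j k = (((T ×ˢ U).filter fun tu => tu.2 k = tu.1 j).card : ℝ) / (T.card * U.card : ℕ))
    (hdC : ∀ k i, dC k i = (((U ×ˢ S).filter fun us => us.2 i = us.1 k).card : ℝ) / (U.card * S.card : ℕ))
    (θC : ℝ) (hθC : 16 / (n : ℝ) ≤ θC)
    (hpC : ∀ k i, pC k i = if θC ≤ dC k i then dC k i - 1 / n else 0)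
    (LL : ℝ) (hLA : Real.log (6 * n.factorial / (S.card * T.card : ℕ)) ≤ LL)
    (k : Fin n) (ε : ℝ) (hε0 : 0 < ε) (hε : ε ≤ 1 / (7776 * (1 + Real.log n) ^ 4))
    (hdom : 1 - ε ≤ ((n : ℝ) - 1) / n * (∑ i : Fin n, pC k i) -
      ((n : ℝ) - 1) * ∑ i : Fin n, pC k i * ∑ j : Fin n, dA i j * dB j k) :
    ((S.card * T.card * U.card : ℕ) : ℝ) ≤
      12288 * (9600 ^ 2 * 9 ^ 4) * (1 + Real.log n) ^ 10 * LL ^ 2 * ε * n * B := by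
  /- 0. scalars; `τ = 1/2 ≥ 2/n` -/
  have hn2 : 2 ≤ n := le_trans (by norm_num) hn
  have hnR4 : (4 : ℝ) ≤ n := by exact_mod_cast hn
  have hnR : (2 : ℝ) ≤ n := by linarith
  have hn0 : (0 : ℝ) < n := by linarith
  obtain ⟨τ, hτdef⟩ : ∃ τ : ℝ, τ = 1 / 2 := ⟨_, rfl⟩
  have hτ : 2 / (n : ℝ) ≤ τ := by
    rw [hτdef, div_le_div_iff₀ hn0 (by norm_num : (0 : ℝ) < 2)]; linarith
  have hτ0 : 0 < τ := by rw [hτdef]; norm_num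
  have hcS0 : (0 : ℝ) < S.card := by exact_mod_cast hS0.card_pos
  have hcT0 : (0 : ℝ) < T.card := by exact_mod_cast hT0.card_pos
  have hcU0 : (0 : ℝ) < U.card := by exact_mod_cast hU0.card_pos
  have hβe : ((T.card * U.card : ℕ) : ℝ) = (T.card : ℝ) * U.card := by push_cast; ring
  have hγe : ((U.card * S.card : ℕ) : ℝ) = (U.card : ℝ) * S.card := by push_cast; ring
  /- 1. profiles: nonnegativity, the unit column sums of `dB` and the unit row sum of `dC` at `k` -/
  have hdA0 : ∀ i j, 0 ≤ dA i j := fun i j => by rw [hdA]; positivity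
  have hdB0 : ∀ j k', 0 ≤ dB j k' := fun j k' => by rw [hdB]; positivity
  have hdC0 : ∀ k' i, 0 ≤ dC k' i := fun k' i => by rw [hdC]; positivity
  have hcolB : ∀ k', ∑ j : Fin n, dB j k' = 1 := by
    intro k'
    have h' : ∑ j : Fin n, (((T ×ˢ U).filter fun tu => tu.2 k' = tu.1 j).card : ℝ) =
        (T.card : ℝ) * U.card := by
      exact_mod_cast sum_pairMarginal_fst T U k'
    simp_rw [hdB _ k', hβe]
    rw [← Finset.sum_div, h', div_self (mul_pos hcT0 hcU0).ne']
  have hrowC : ∑ i : Fin n, dC k i = 1 := by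
    have h' : ∑ i : Fin n, (((U ×ˢ S).filter fun us => us.2 i = us.1 k).card : ℝ) =
        (U.card : ℝ) * S.card := by
      exact_mod_cast sum_pairMarginal_snd U S k
    simp_rw [hdC k, hγe]
    rw [← Finset.sum_div, h', div_self (mul_pos hcU0 hcS0).ne']
  /- 2. the heavy part `pC` -/
  have hθC0 : 0 < θC := lt_of_lt_of_le (div_pos (by norm_num) hn0) hθC
  have hinvC : 1 / (n : ℝ) ≤ θC / 16 := by
    rw [div_le_div_iff₀ hn0 (by norm_num : (0 : ℝ) < 16)]; rw [div_le_iff₀ hn0] at hθC; linarith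
  have h1n : (0 : ℝ) ≤ 1 / n := by positivity
  have hpC0 : ∀ k' i, 0 ≤ pC k' i := by
    intro k' i; rw [hpC]; split_ifs with h <;> linarith [hinvC, hθC0]
  have hpCle : ∀ k' i, pC k' i ≤ dC k' i := by
    intro k' i; rw [hpC]; split_ifs with h <;> linarith [hdC0 k' i, h1n]
  have hpCheavy : ∀ k' i, θC ≤ dC k' i → dC k' i ≤ 16 / 15 * pC k' i := fun k' i h => by
    rw [hpC, if_pos h]; linarith [hinvC]
  /- 3. dominance: the hub row `Σ_i pC(k,i) ≥ τ` and the local forced hits `Φ_k ≤ 2ε/n` -/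
  have hAB0 : ∀ k' i, 0 ≤ ∑ j : Fin n, dA i j * dB j k' := fun k' i =>
    Finset.sum_nonneg fun j _ => mul_nonneg (hdA0 i j) (hdB0 j k')
  have hρ0 : 0 ≤ ∑ i : Fin n, pC k i := Finset.sum_nonneg fun i _ => hpC0 k i
  have hρ1 : ∑ i : Fin n, pC k i ≤ 1 := by
    rw [← hrowC]; exact Finset.sum_le_sum fun i _ => hpCle k i
  have hΦ0 : 0 ≤ ∑ i : Fin n, pC k i * ∑ j : Fin n, dA i j * dB j k :=
    Finset.sum_nonneg fun i _ => mul_nonneg (hpC0 k i) (hAB0 k i)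
  have hm0 : (0 : ℝ) ≤ (n : ℝ) - 1 := by linarith
  have hfrac0 : 0 ≤ ((n : ℝ) - 1) / n := div_nonneg hm0 hn0.le
  have hfrac1 : ((n : ℝ) - 1) / n ≤ 1 := by rw [div_le_one hn0]; linarith
  have hfracρ : ((n : ℝ) - 1) / n * ∑ i : Fin n, pC k i ≤ ∑ i : Fin n, pC k i :=
    mul_le_of_le_one_left hρ0 hfrac1
  have hfracρ' : ((n : ℝ) - 1) / n * ∑ i : Fin n, pC k i ≤ ((n : ℝ) - 1) / n :=
    mul_le_of_le_one_right hfrac0 hρ1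
  have hmΦ : 0 ≤ ((n : ℝ) - 1) * ∑ i : Fin n, pC k i * ∑ j : Fin n, dA i j * dB j k :=
    mul_nonneg hm0 hΦ0
  have hG1 : (1 : ℝ) ≤ 1 + Real.log n := by
    have h := Real.log_nonneg (show (1 : ℝ) ≤ n by linarith)
    linarith
  have hG4 : (1 : ℝ) ≤ (1 + Real.log n) ^ 4 := one_le_pow₀ hG1
  have hG40 : (0 : ℝ) < 7776 * (1 + Real.log n) ^ 4 := by positivity
  have hε1 : ε ≤ 1 / 7776 :=
    hε.trans (div_le_div_of_nonneg_left (by norm_num) (by norm_num) (by linarith))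
  have hk : τ ≤ ∑ i : Fin n, pC k i := by rw [hτdef]; linarith
  have hΦk : ((n : ℝ) - 1) * ∑ i : Fin n, pC k i * ∑ j : Fin n, dA i j * dB j k ≤ ε := by
    linarith
  have hΦn : ∑ i : Fin n, pC k i * ∑ j : Fin n, dA i j * dB j k ≤ 2 * ε / n := by
    rw [le_div_iff₀ hn0]
    have hprod : 0 ≤ (∑ i : Fin n, pC k i * ∑ j : Fin n, dA i j * dB j k) * ((n : ℝ) - 2) :=
      mul_nonneg hΦ0 (by linarith)
    nlinarith [hprod, hΦk, hΦ0]
  /- 4. the blocks `J`, `I`, and `q` -/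
  obtain ⟨J, hJdef⟩ : ∃ J : Finset (Fin n),
      J = Finset.univ.filter (fun j => 1 / (n : ℝ) ^ 2 ≤ dB j k) := ⟨_, rfl⟩
  obtain ⟨I, hIdef⟩ : ∃ I : Finset (Fin n), I = Finset.univ.filter (fun i => θC ≤ dC k i) :=
    ⟨_, rfl⟩
  have hJ : ∀ j ∈ J, 1 / (n : ℝ) ^ 2 ≤ dB j k := fun j hj => by
    rw [hJdef, Finset.mem_filter] at hj; exact hj.2
  have hIθ : ∀ i ∈ I, θC ≤ dC k i := fun i hi => by
    rw [hIdef, Finset.mem_filter] at hi; exact hi.2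
  have hn2le : 1 / (n : ℝ) ^ 2 ≤ 16 / n := by
    rw [div_le_div_iff₀ (by positivity) hn0]; nlinarith [hnR, hn0]
  have hI : ∀ i ∈ I, 1 / (n : ℝ) ^ 2 ≤ dC k i := fun i hi => (hn2le.trans hθC).trans (hIθ i hi)
  obtain ⟨q, hqdef⟩ : ∃ q : ℝ, q = (τ - 1 / n) / 2 := ⟨_, rfl⟩
  have h2n : 1 / (n : ℝ) ≤ τ / 2 := by
    rw [div_le_div_iff₀ hn0 (by norm_num : (0 : ℝ) < 2)]; rw [div_le_iff₀ hn0] at hτ; linarith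
  have hq4 : τ / 4 ≤ q := by rw [hqdef]; linarith [h2n]
  have hq0 : 0 < q := lt_of_lt_of_le (div_pos hτ0 (by norm_num)) hq4
  have h2q : 2 * q = τ - 1 / n := by rw [hqdef]; ring
  /- 5. the value distribution `μ` of `U` at `k` and the block profiles `X`, `Y` of `T`, `S` -/
  obtain ⟨μ, hμ⟩ : ∃ μ : Fin n → ℝ, ∀ v, μ v = ((U.filter fun u => u k = v).card : ℝ) / U.card :=
    ⟨_, fun v => rfl⟩
  obtain ⟨X, hX⟩ : ∃ X : Fin n → ℝ, ∀ v, X v = ((T.filter fun t => t⁻¹ v ∈ J).card : ℝ) / T.card :=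
    ⟨_, fun v => rfl⟩
  obtain ⟨Y, hY⟩ : ∃ Y : Fin n → ℝ, ∀ v, Y v = ((S.filter fun s => s⁻¹ v ∈ I).card : ℝ) / S.card :=
    ⟨_, fun v => rfl⟩
  have hμ0 : ∀ v, 0 ≤ μ v := fun v => by rw [hμ]; positivity
  have hX1 : ∀ v, X v ≤ 1 := fun v => by
    rw [hX, div_le_one hcT0]; exact_mod_cast Finset.card_filter_le _ _
  have hY1 : ∀ v, Y v ≤ 1 := fun v => by
    rw [hY, div_le_one hcS0]; exact_mod_cast Finset.card_filter_le _ _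
  have hμ1 : ∑ v : Fin n, μ v = 1 := by
    simp_rw [hμ]
    rw [← Finset.sum_div, sum_marginal_col U k, div_self hcU0.ne']
  -- `Σ_{j ∈ J} dB(j,k) = Σ_v μ X` and `Σ_{i ∈ I} dC(k,i) = Σ_v μ Y`
  have hσ : ∑ j ∈ J, dB j k = ∑ v : Fin n, μ v * X v := by
    have hcol : ∑ j ∈ J, (((T ×ˢ U).filter fun tu => tu.2 k = tu.1 j).card : ℝ) = ∑ v : Fin n,
        ((U.filter fun u => u k = v).card : ℝ) * ((T.filter fun t => t⁻¹ v ∈ J).card : ℝ) := by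
      exact_mod_cast sum_pairMarginal_col_block_eq T U J k
    simp_rw [hdB _ k, hβe]
    rw [← Finset.sum_div, hcol, Finset.sum_div]
    refine Finset.sum_congr rfl fun v _ => ?_
    rw [hμ, hX, div_mul_div_comm, mul_comm (U.card : ℝ) (T.card : ℝ)]
  have hρ : ∑ i ∈ I, dC k i = ∑ v : Fin n, μ v * Y v := by
    have hrow : ∑ i ∈ I, (((U ×ˢ S).filter fun us => us.2 i = us.1 k).card : ℝ) = ∑ v : Fin n,
        ((U.filter fun u => u k = v).card : ℝ) * ((S.filter fun s => s⁻¹ v ∈ I).card : ℝ) := by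
      exact_mod_cast sum_pairMarginal_row_block_eq U S I k
    simp_rw [hdC k, hγe]
    rw [← Finset.sum_div, hrow, Finset.sum_div]
    refine Finset.sum_congr rfl fun v _ => ?_
    rw [hμ, hY, div_mul_div_comm]
  /- 6. hub mass `Σ_v μ X Y ≥ 2q` -/
  have hpI : ∑ i ∈ I, pC k i = ∑ i : Fin n, pC k i := by
    rw [hIdef, Finset.sum_filter]
    refine Finset.sum_congr rfl fun i _ => ?_
    split_ifs with h
    · rfl
    · rw [hpC, if_neg h]
  have hρτ : τ ≤ ∑ v : Fin n, μ v * Y v := by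
    rw [← hρ]
    calc τ ≤ ∑ i : Fin n, pC k i := hk
      _ = ∑ i ∈ I, pC k i := hpI.symm
      _ ≤ ∑ i ∈ I, dC k i := Finset.sum_le_sum fun i _ => hpCle k i
  have hσ1 : 1 - 1 / n ≤ ∑ v : Fin n, μ v * X v := by
    rw [← hσ]
    have hsplit := Finset.sum_filter_add_sum_filter_not Finset.univ
      (fun j => 1 / (n : ℝ) ^ 2 ≤ dB j k) (fun j => dB j k)
    rw [hcolB k, ← hJdef] at hsplit
    have hcomp : ∑ j ∈ Finset.univ.filter (fun j => ¬ (1 / (n : ℝ) ^ 2 ≤ dB j k)), dB j k ≤ 1 / n :=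
      calc ∑ j ∈ Finset.univ.filter (fun j => ¬ (1 / (n : ℝ) ^ 2 ≤ dB j k)), dB j k
          ≤ ∑ j ∈ Finset.univ.filter (fun j => ¬ (1 / (n : ℝ) ^ 2 ≤ dB j k)), 1 / (n : ℝ) ^ 2 :=
            Finset.sum_le_sum fun j hj => (not_le.1 (Finset.mem_filter.1 hj).2).le
        _ ≤ ∑ _j : Fin n, 1 / (n : ℝ) ^ 2 :=
            Finset.sum_le_sum_of_subset_of_nonneg (Finset.filter_subset _ _) fun _ _ _ => by
              positivity
        _ = 1 / n := by
            rw [Finset.sum_const, Finset.card_univ, Fintype.card_fin, nsmul_eq_mul]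
            field_simp
    linarith [hsplit, hcomp]
  have hlowμ : 2 * q ≤ ∑ v : Fin n, μ v * (X v * Y v) := by
    have h := dominantRow_sum_mul_mul_ge Finset.univ μ X Y (fun v _ => hμ0 v) (fun v _ => hX1 v)
      (fun v _ => hY1 v)
    linarith [hρτ, hσ1, h2q, h, hμ1]
  have hlow : 2 * q ≤ ∑ v : Fin n, ((U.filter fun u => u k = v).card : ℝ) / U.card *
      ((((T.filter fun t => t⁻¹ v ∈ J).card : ℝ) / T.card) *
        (((S.filter fun s => s⁻¹ v ∈ I).card : ℝ) / S.card)) :=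
    calc 2 * q ≤ _ := hlowμ
      _ = _ := Finset.sum_congr rfl fun v _ => by rw [hμ, hX, hY]
  /- 7. the block weight `Σ_{I × J} dA dB dC ≤ 3ε/n` (local forced hits) -/
  have hΨ : ∑ i ∈ I, ∑ j ∈ J, dA i j * dB j k * dC k i ≤ 3 * ε / n := by
    have h1 : ∑ i ∈ I, ∑ j ∈ J, dA i j * dB j k * dC k i ≤
        ∑ i ∈ I, dC k i * ∑ j : Fin n, dA i j * dB j k := by
      refine Finset.sum_le_sum fun i _ => ?_
      rw [Finset.mul_sum]
      calc ∑ j ∈ J, dA i j * dB j k * dC k i ≤ ∑ j : Fin n, dA i j * dB j k * dC k i :=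
            Finset.sum_le_sum_of_subset_of_nonneg (Finset.subset_univ _) fun j _ _ =>
              mul_nonneg (mul_nonneg (hdA0 i j) (hdB0 j k)) (hdC0 k i)
        _ = ∑ j : Fin n, dC k i * (dA i j * dB j k) := Finset.sum_congr rfl fun j _ => by ring
    have h2 : ∑ i ∈ I, dC k i * ∑ j : Fin n, dA i j * dB j k ≤
        ∑ i : Fin n, 16 / 15 * (pC k i * ∑ j : Fin n, dA i j * dB j k) :=
      calc ∑ i ∈ I, dC k i * ∑ j : Fin n, dA i j * dB j k
          ≤ ∑ i ∈ I, 16 / 15 * (pC k i * ∑ j : Fin n, dA i j * dB j k) :=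
            Finset.sum_le_sum fun i hi => by
              rw [← mul_assoc]
              exact mul_le_mul_of_nonneg_right (hpCheavy k i (hIθ i hi)) (hAB0 k i)
        _ ≤ ∑ i : Fin n, 16 / 15 * (pC k i * ∑ j : Fin n, dA i j * dB j k) :=
            Finset.sum_le_sum_of_subset_of_nonneg (Finset.subset_univ _) fun i _ _ =>
              mul_nonneg (by norm_num) (mul_nonneg (hpC0 k i) (hAB0 k i))
    rw [← Finset.mul_sum] at h2
    calc ∑ i ∈ I, ∑ j ∈ J, dA i j * dB j k * dC k i
        ≤ ∑ i ∈ I, dC k i * ∑ j : Fin n, dA i j * dB j k := h1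
      _ ≤ 16 / 15 * ∑ i : Fin n, pC k i * ∑ j : Fin n, dA i j * dB j k := h2
      _ ≤ 16 / 15 * (2 * ε / n) := mul_le_mul_of_nonneg_left hΦn (by norm_num)
      _ = (32 / 15 * ε) / n := by ring
      _ ≤ 3 * ε / n := div_le_div_of_nonneg_right (by linarith) hn0.le
  /- 8. `81(1+log n)⁴·(3ε) ≤ 2q²` -/
  have hηq : 1944 * (1 + Real.log n) ^ 4 * ε ≤ τ ^ 2 := by
    have hε' := hε
    rw [le_div_iff₀ hG40] at hε'
    rw [hτdef]; nlinarith [hε']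
  have hηq' : 81 * (1 + Real.log n) ^ 4 * (3 * ε) ≤ 2 * q ^ 2 := by
    have hq2 : (τ / 4) ^ 2 ≤ q ^ 2 := pow_le_pow_left₀ (div_pos hτ0 (by norm_num)).le hq4 2
    have hG4' : 0 ≤ (1 + Real.log n) ^ 4 := by positivity
    nlinarith [hηq, hq2, hG4', hε0]
  /- 9. the general hub lemma and the final arithmetic -/
  have hmain := hub_volume_dyadic hn2 B hB hTPP hS0 hT0 hU0 dA dB dC hdA hdB hdC k J I q (3 * ε) hq0
    (by positivity) hJ hI hlow hΨ hηq'
  have hL0 : 0 ≤ Real.log (6 * n.factorial / (S.card * T.card : ℕ)) := by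
    apply Real.log_nonneg
    have hST : ((S.card * T.card : ℕ) : ℝ) ≤ n.factorial := by
      exact_mod_cast card_mul_card_le_factorial_of_injOn (injOn_quot_first hTPP hU0)
    have hST0 : (0 : ℝ) < ((S.card * T.card : ℕ) : ℝ) := by push_cast; exact mul_pos hcS0 hcT0
    rw [le_div_iff₀ hST0]
    have h0 : (0 : ℝ) ≤ n.factorial := Nat.cast_nonneg _
    linarith
  have hq8 : 1 / 8 ≤ q := by rw [hτdef] at hq4; linarith
  exact dominantRow_arith _ (1 + Real.log n) _ LL n ε B q hL0 hLA hq8 hn0 hε0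
    (Nat.cast_nonneg B) hmain

end Summit.MatrixMultiplication.MatrixMultiplication.Theorems.PolynomialSlack
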